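import Summits.AtomisticToContinuum.FouriersLaw.Theorems.LatticeLandauDampingAbelThermodynamicLimitFixedFrequencyMatchingOfFixedTime
import Summits.AtomisticToContinuum.FouriersLaw.Theorems.LatticeLandauDampingAbelThermodynamicLimitFixedFrequencyMatchingPairSums
import HarnessLib

/-!
# `stub_fixedFrequencyMatching` of line `series-law-at-every-laplace-frequency`, part 4:
the fixed-time bond-averaged matching from the two ANCHOR-UNIFORM dynamical leaves
(crux `LatticeLandauDamping.AbelThermodynamicLimit`, item stmt-AtomisticToContinuum-14013, `Iff.rfl`-identical
to `EmbeddedDrudeMourre.AbelThermodynamicLimit`, stmt-AtomisticToContinuum-12596; `--supports` helper file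
proving the registered reduction stub `stub_fixedTimeMatchingOfUniformLeaves`, closes nothing)

Part 2 reduced the registered stub S3 `stub_fixedFrequencyMatching` (per-length current resolvent form of
the OPEN chain, `F_N(ν)/N → ∫₀^∞ e^{-νt} C_T(t) dt`, for regular witnesses) to the FIXED-TIME bond-averaged
matching `c_N(t)/N → C_T(t)`, where `c_N(t) = ∫ J · (P_t J) dμ_{N,T} = Σ_i Σ_k K_N(i,k,t)` (part 3),
`K_N(i,k,t) = ⟨j_i(0) j_k(t)⟩_{N,T} = ∫ j_i · (P_t j_k) dμ_{N,T}` are the equilibrium pair correlations of the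
bond currents of the open `N`-chain (both baths at `T`), `C_T(t) = Σ_x c_x(t)` and
`c_x(t) = ∫ j_0 · (j_x ∘ φ_t) dμT` are the witness's offset correlations.

This file (sorry-free) reduces the fixed-time matching to the ANCHOR-UNIFORM forms of the two dynamical
leaves of the sibling line `loomis-compact-horizon-witness` (`stub_fixedHorizonMatchingOfDynamicalLeaves`,
anchored at the central bond): (B') anchor-uniform per-offset fixed-time matching
`|K_N(i, i + x, t) - c_x(t)| ≤ ε` for `N ≥ N₀` and all `L`-deep anchors `i` (two-dynamics coupling on bulk
windows + convergence of the bulk window laws of `gibbsMeasure N T` to the regular DLR state); (C')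
anchor-uniform correlation tails `Σ_{|k-i|>R} |K_N(i,k,t)| ≤ ε` for `N ≥ N₀` and all `R`-deep anchors (light
cone of the open chain at fixed time). `tendsto_totalCurrentAutocorr_div_of_uniformLeaves`: (B') + (C') +
absolute convergence of the witness's correlation sum ⟹ `c_N(t)/N → C_T(t)` (bulk rows within `3ε` of
`C_T(t)`; the `≤ 2L'` boundary rows are `≤ ½(λM + 3MN/λ) + |C_T(t)|` for every `λ > 0`, part 3, i.e. `o(N)`
in the bond average). `stub_fixedTimeMatchingOfUniformLeaves` (registered) and
`fixedFrequencyMatching_of_uniformLeaves`: S3's hypotheses + (B') + (C') ⟹ S3's conclusion (via part 2). So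
S3 follows BY NAME from the two anchor-uniform dynamical leaves; neither is in the tree.
References: Bonetto–Lebowitz–Rey-Bellet 2000 §7; Buttà–Marchioro 2016; Kundu–Dhar–Narayan 2009.
-/

noncomputable section

open MeasureTheory ProbabilityTheory Filter Topology Set Function
open scoped NNReal ENNReal

namespace Summit.AtomisticToContinuum.FouriersLaw.Theorems.AbelThermodynamicLimit.SeriesLawAtEveryLaplaceFrequency

open Literature.MathematicalPhysics.KineticTheory.HeatConduction
open Literature.MathematicalPhysics.KineticTheory OscillatorChain
open Summit.AtomisticToContinuum.FouriersLaw.Theorems.SubdiffusiveBondHeat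
open Summit.AtomisticToContinuum.FouriersLaw.Theorems.LightConeBondHeat
open Summit.AtomisticToContinuum.FouriersLaw.Theorems.OddSectorIrreversibility
open Summit.AtomisticToContinuum.FouriersLaw.Theorems.OddSectorIrreversibility.Corrector
open Summit.AtomisticToContinuum.FouriersLaw.Theorems.AbelThermodynamicLimit.LoomisCompactHorizonWitness

/-! ## The bond-averaged fixed-time matching from the two anchor-uniform dynamical leaves -/

/-- **Fixed-time bond-averaged matching from anchor-uniform leaves** (parameter-point form). For
`P = pinnedChain ω₂ lam β γ` (all `> 0`), `T > 0`, a dynamics `D` and a state `μT` whose summed current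
correlation converges absolutely at time `t`, the pair correlations `K_N(i,k,t) = ⟨j_i(0) j_k(t)⟩_{N,T}` of
the OPEN `N`-chain and the offset correlations `c_x(t) = ∫ j_0 · (j_x ∘ φ_t) dμT` of the witness:
(B') `|K_N(i, i + x, t) - c_x(t)| ≤ ε` for `N ≥ N₀(x,ε)` and all anchors `i` with `L ≤ i`, `i + L < N`
(`L = L(x,ε)`), and (C') `Σ_{|k - i| > R} |K_N(i,k,t)| ≤ ε` for `N ≥ N₀(ε)` and all anchors with `R ≤ i`,
`i + R < N` (`R = R(ε)`), imply `c_N(t)/N → C_T(t) = Σ_x c_x(t)`, `c_N(t) = Σ_i Σ_k K_N(i,k,t)`.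
Proof: bulk rows are within `3ε` of `C_T(t)` (window by (B') after reindexing by offsets, open-chain
tail by (C'), witness tail by absolute convergence); the `≤ 2L'` boundary rows are `O(λ + N/λ)` by the
weighted pairing bound, hence `o(N)` after the bond average (`λ → ∞` after `N → ∞`). [folklore] -/
theorem tendsto_totalCurrentAutocorr_div_of_uniformLeaves {ω₂ lam β γ : ℝ} (hω : 0 < ω₂) (hl : 0 < lam)
    (hβ : 0 < β) (hγ : 0 < γ) {T : ℝ} (hT : 0 < T) {μT : Measure ChainConfig}
    {D : InfiniteChainDynamics (pinnedChain ω₂ lam β γ)} {t : ℝ}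
    (hAC : D.HasAbsConvergentCorrelation μT t)
    (hB : ∀ (x : ℤ) (ε : ℝ), 0 < ε → ∃ L N₀ : ℕ, ∀ N : ℕ, N₀ ≤ N → ∀ i k : Fin N,
      L ≤ i.val → i.val + L < N → (k.val : ℤ) = i.val + x →
        |(∫ z, (pinnedChain ω₂ lam β γ).bondCurrent N i z *
            (∫ y, (pinnedChain ω₂ lam β γ).bondCurrent N k y
              ∂((pinnedChain ω₂ lam β γ).transitionKernel N T T t.toNNReal z))
            ∂((pinnedChain ω₂ lam β γ).gibbsMeasure N T)) -
          ∫ σ, (pinnedChain ω₂ lam β γ).bondCurrentZ σ 0 *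
            (pinnedChain ω₂ lam β γ).bondCurrentZ (D.flow t σ) x ∂μT| ≤ ε)
    (hC : ∀ ε : ℝ, 0 < ε → ∃ R N₀ : ℕ, ∀ N : ℕ, N₀ ≤ N → ∀ i : Fin N, R ≤ i.val → i.val + R < N →
      (∑ k : Fin N, if i.val ≤ k.val + R ∧ k.val ≤ i.val + R then (0 : ℝ) else
        |∫ z, (pinnedChain ω₂ lam β γ).bondCurrent N i z *
            (∫ y, (pinnedChain ω₂ lam β γ).bondCurrent N k y
              ∂((pinnedChain ω₂ lam β γ).transitionKernel N T T t.toNNReal z))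
          ∂((pinnedChain ω₂ lam β γ).gibbsMeasure N T)|) ≤ ε) :
    Tendsto (fun N : ℕ => (∫ z, (∑ i : Fin N, (pinnedChain ω₂ lam β γ).bondCurrent N i z) *
        (∫ y, (∑ i : Fin N, (pinnedChain ω₂ lam β γ).bondCurrent N i y)
          ∂((pinnedChain ω₂ lam β γ).transitionKernel N T T t.toNNReal z))
        ∂((pinnedChain ω₂ lam β γ).gibbsMeasure N T)) / (N : ℝ))
      atTop (𝓝 (D.currentCorrelation μT t)) := by
  -- the pair correlations of the open chain and the offset correlations of the witness
  set K : (N : ℕ) → Fin N → Fin N → ℝ := fun N i k => ∫ z, (pinnedChain ω₂ lam β γ).bondCurrent N i z *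
      (∫ y, (pinnedChain ω₂ lam β γ).bondCurrent N k y
        ∂((pinnedChain ω₂ lam β γ).transitionKernel N T T t.toNNReal z))
      ∂((pinnedChain ω₂ lam β γ).gibbsMeasure N T) with hK
  set cx : ℤ → ℝ := fun x => ∫ σ, (pinnedChain ω₂ lam β γ).bondCurrentZ σ 0 *
    (pinnedChain ω₂ lam β γ).bondCurrentZ (D.flow t σ) x ∂μT with hcx
  set CT : ℝ := D.currentCorrelation μT t with hCTdef
  have hB' : ∀ (x : ℤ) (ε : ℝ), 0 < ε → ∃ L N₀ : ℕ, ∀ N : ℕ, N₀ ≤ N → ∀ i k : Fin N,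
      L ≤ i.val → i.val + L < N → (k.val : ℤ) = i.val + x → |K N i k - cx x| ≤ ε := hB
  have hC' : ∀ ε : ℝ, 0 < ε → ∃ R N₀ : ℕ, ∀ N : ℕ, N₀ ≤ N → ∀ i : Fin N, R ≤ i.val → i.val + R < N →
      (∑ k : Fin N, if i.val ≤ k.val + R ∧ k.val ≤ i.val + R then (0 : ℝ) else |K N i k|) ≤ ε := hC
  -- the witness side: `Σ_{|x| ≤ n} c_x(t) → C_T(t)`
  have hsum : Summable cx := hAC.2.of_abs
  have hlimW : Tendsto (fun n : ℕ => ∑ x ∈ Finset.Icc (-(n : ℤ)) n, cx x) atTop (𝓝 CT) := by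
    have h := hsum.hasSum
    rw [HasSum, SummationFilter.unconditional_filter] at h
    exact h.comp Finset.tendsto_Icc_neg
  -- `N`-uniform second moments, the double-sum form of `c_N`, the row bound
  obtain ⟨M, hM⟩ := pinnedChain_integral_sq_bondCurrent_gibbsMeasure_le (γ := γ) hω hl hβ hT
  have hM0 : 0 ≤ M := (integral_nonneg fun z => sq_nonneg _).trans (hM 1 0)
  have hcN : ∀ N : ℕ, 0 < N → (∫ z, (∑ i : Fin N, (pinnedChain ω₂ lam β γ).bondCurrent N i z) *
      (∫ y, (∑ i : Fin N, (pinnedChain ω₂ lam β γ).bondCurrent N i y)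
        ∂((pinnedChain ω₂ lam β γ).transitionKernel N T T t.toNNReal z))
        ∂((pinnedChain ω₂ lam β γ).gibbsMeasure N T)) = ∑ i : Fin N, ∑ k : Fin N, K N i k := fun N hN =>
    totalCurrentAutocorr_eq_sum_sum_pairCorr hω hl hβ hγ hN hT t
  have hrowbd : ∀ N : ℕ, 0 < N → ∀ (i : Fin N) (lam' : ℝ), 0 < lam' →
      |∑ k : Fin N, K N i k| ≤ (lam' * M + lam'⁻¹ * (3 * M * N)) / 2 := fun N hN i lam' hlam =>
    abs_sum_pairCorr_le_weighted hω hl hβ hγ hN hT (hM N) i t hlam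
  rw [Metric.tendsto_atTop]
  intro ε hε
  set δ : ℝ := ε / 6 with hδ
  have hδ0 : 0 < δ := by positivity
  -- the window radius `R`
  obtain ⟨R₁, hR₁⟩ := (Metric.tendsto_atTop.1 hlimW) δ hδ0
  obtain ⟨R₂, N₁, hR₂⟩ := hC' δ hδ0
  set R : ℕ := max R₁ R₂ with hRdef
  -- per-offset matching, uniformly over the offsets `|x| ≤ R`
  have hδ' : 0 < δ / (2 * R + 1) := by positivity
  obtain ⟨L, N₂, hL⟩ : ∃ L N₂ : ℕ, ∀ x ∈ Finset.Icc (-(R : ℤ)) R, ∀ N : ℕ, N₂ ≤ N → ∀ i k : Fin N,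
      L ≤ i.val → i.val + L < N → (k.val : ℤ) = i.val + x → |K N i k - cx x| ≤ δ / (2 * R + 1) := by
    have hev : ∀ x ∈ Finset.Icc (-(R : ℤ)) R, ∀ᶠ p : ℕ × ℕ in atTop, ∀ N : ℕ, p.2 ≤ N →
        ∀ i k : Fin N, p.1 ≤ i.val → i.val + p.1 < N → (k.val : ℤ) = i.val + x →
          |K N i k - cx x| ≤ δ / (2 * R + 1) := by
      intro x _
      obtain ⟨L, N₀, h⟩ := hB' x _ hδ'
      refine Filter.eventually_atTop.2 ⟨(L, N₀), fun p hp N hN i k hi hiN hk => ?_⟩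
      obtain ⟨hp1, hp2⟩ := hp
      dsimp only at hp1 hp2
      exact h N (le_trans hp2 hN) i k (le_trans hp1 hi) (by omega) hk
    obtain ⟨p, hp⟩ := Filter.eventually_atTop.1 ((Filter.eventually_all_finset _).2 hev)
    exact ⟨p.1, p.2, fun x hx => hp p le_rfl x hx⟩
  set L' : ℕ := max L R with hL'def
  have hRL' : R ≤ L' := le_max_right _ _
  have hLL' : L ≤ L' := le_max_left _ _
  have hR₁R : R₁ ≤ R := le_max_left _ _
  have hR₂R : R₂ ≤ R := le_max_right _ _
  -- the boundary rows: the weight `λ`, then `N`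
  set lam' : ℝ := 3 * L' * M / δ + 1 with hlam'def
  have hlam' : 0 < lam' := by positivity
  set A : ℝ := (L' : ℝ) * lam' * M + 2 * L' * |CT| with hAdef
  have hA0 : 0 ≤ A := by positivity
  refine ⟨max (max N₁ N₂) (max (⌈A / δ⌉₊) 1), fun N hN => ?_⟩
  have hN₁ : N₁ ≤ N := le_trans (le_trans (le_max_left _ _) (le_max_left _ _)) hN
  have hN₂ : N₂ ≤ N := le_trans (le_trans (le_max_right _ _) (le_max_left _ _)) hN
  have hN₄ : ⌈A / δ⌉₊ ≤ N := le_trans (le_trans (le_max_left _ _) (le_max_right _ _)) hN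
  have hNpos : 0 < N := lt_of_lt_of_le Nat.one_pos (le_trans (le_trans (le_max_right _ _) (le_max_right _ _)) hN)
  have hNr : (0 : ℝ) < N := by exact_mod_cast hNpos
  rw [Real.dist_eq, hcN N hNpos]
  -- rows
  set row : Fin N → ℝ := fun i => ∑ k : Fin N, K N i k with hrow
  have e1 : (∑ i : Fin N, row i) / (N : ℝ) - CT = (∑ i : Fin N, (row i - CT)) / N := by
    rw [Finset.sum_sub_distrib, Finset.sum_const, Finset.card_univ, Fintype.card_fin, nsmul_eq_mul]
    field_simp
  rw [e1, abs_div, abs_of_pos hNr, div_lt_iff₀ hNr]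
  -- bulk rows are within `3δ` of `C_T(t)`
  have hbulk : ∀ i : Fin N, L' ≤ i.val → i.val + L' < N → |row i - CT| ≤ 3 * δ := by
    intro i hi1 hi2
    have hiR : R ≤ i.val := le_trans hRL' hi1
    have hiRN : i.val + R < N := by omega
    have hiL : L ≤ i.val := le_trans hLL' hi1
    have hiLN : i.val + L < N := by omega
    have hiR₂ : R₂ ≤ i.val := le_trans hR₂R hiR
    have hiR₂N : i.val + R₂ < N := by omega
    -- window / tail split of the row
    have e3 : row i = (∑ k : Fin N, if i.val ≤ k.val + R ∧ k.val ≤ i.val + R then K N i k else 0) +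
        ∑ k : Fin N, if i.val ≤ k.val + R ∧ k.val ≤ i.val + R then 0 else K N i k := by
      simp only [hrow]
      rw [← Finset.sum_add_distrib]
      refine Finset.sum_congr rfl fun k _ => ?_
      split_ifs <;> simp
    -- the open-chain tail, by (C')
    have htail : |∑ k : Fin N, if i.val ≤ k.val + R ∧ k.val ≤ i.val + R then (0 : ℝ) else K N i k| ≤ δ := by
      refine (Finset.abs_sum_le_sum_abs _ _).trans ?_
      have e4 : (∑ k : Fin N, |if i.val ≤ k.val + R ∧ k.val ≤ i.val + R then (0 : ℝ) else K N i k|) =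
          ∑ k : Fin N, if i.val ≤ k.val + R ∧ k.val ≤ i.val + R then (0 : ℝ) else |K N i k| :=
        Finset.sum_congr rfl fun k _ => by split_ifs <;> simp
      rw [e4]
      exact (tail_antitone' i hR₂R (K N i)).trans (hR₂ N hN₁ i hiR₂ hiR₂N)
    -- the window against the witness's partial sum, by (B') offset by offset
    set s : ℝ := ∑ x ∈ Finset.Icc (-(R : ℤ)) R, cx x with hs
    have hsCT : |s - CT| < δ := by
      have h := hR₁ R hR₁R
      rwa [Real.dist_eq] at h
    have es : s = ∑ k : Fin N, if i.val ≤ k.val + R ∧ k.val ≤ i.val + R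
        then cx ((k.val : ℤ) - i.val) else 0 :=
      (sum_ite_window_offset_eq_sum_Icc hiR hiRN cx).symm
    have hwin : |(∑ k : Fin N, if i.val ≤ k.val + R ∧ k.val ≤ i.val + R then K N i k else 0) - s| ≤ δ := by
      rw [es, ← Finset.sum_sub_distrib]
      calc |∑ k : Fin N, ((if i.val ≤ k.val + R ∧ k.val ≤ i.val + R then K N i k else 0) -
              (if i.val ≤ k.val + R ∧ k.val ≤ i.val + R then cx ((k.val : ℤ) - i.val) else 0))|
          ≤ ∑ k : Fin N, |(if i.val ≤ k.val + R ∧ k.val ≤ i.val + R then K N i k else 0) -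
              (if i.val ≤ k.val + R ∧ k.val ≤ i.val + R then cx ((k.val : ℤ) - i.val) else 0)| :=
            Finset.abs_sum_le_sum_abs _ _
        _ ≤ ∑ k : Fin N, if i.val ≤ k.val + R ∧ k.val ≤ i.val + R then δ / (2 * R + 1) else 0 := by
            refine Finset.sum_le_sum fun k _ => ?_
            split_ifs with hk
            · have hx : (k.val : ℤ) - i.val ∈ Finset.Icc (-(R : ℤ)) R := by
                simp only [Finset.mem_Icc]; omega
              exact hL _ hx N hN₂ i k hiL hiLN (by omega)
            · simp
        _ ≤ (2 * R + 1) * (δ / (2 * R + 1)) := sum_ite_window_const_le' R i hδ'.le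
        _ = δ := by field_simp
    have key : row i - CT =
        ((∑ k : Fin N, if i.val ≤ k.val + R ∧ k.val ≤ i.val + R then K N i k else 0) - s) + (s - CT) +
          ∑ k : Fin N, if i.val ≤ k.val + R ∧ k.val ≤ i.val + R then 0 else K N i k := by
      rw [e3]; ring
    rw [key]
    refine (abs_add_three _ _ _).trans ?_
    linarith [hsCT.le]
  -- every row is bounded by `Rb = ½(λM + 3MN/λ) + |C_T(t)|`
  set Rb : ℝ := (lam' * M + lam'⁻¹ * (3 * M * N)) / 2 + |CT| with hRb
  have hRb0 : 0 ≤ Rb := by positivity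
  have hbdry : ∀ i : Fin N, |row i - CT| ≤ Rb := fun i =>
    (abs_sub_le_abs_add_abs _ _).trans (add_le_add (hrowbd N hNpos i lam' hlam') le_rfl)
  -- bulk / boundary split of the bond average
  have e2 : ∑ i : Fin N, (row i - CT) =
      (∑ i : Fin N, if L' ≤ i.val ∧ i.val + L' < N then row i - CT else 0) +
        ∑ i : Fin N, if L' ≤ i.val ∧ i.val + L' < N then 0 else row i - CT := by
    rw [← Finset.sum_add_distrib]
    refine Finset.sum_congr rfl fun i _ => ?_
    split_ifs <;> simp
  have hsum1 : |∑ i : Fin N, if L' ≤ i.val ∧ i.val + L' < N then row i - CT else 0| ≤ 3 * δ * N := by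
    refine (Finset.abs_sum_le_sum_abs _ _).trans ?_
    calc (∑ i : Fin N, |if L' ≤ i.val ∧ i.val + L' < N then row i - CT else 0|)
        ≤ ∑ _i : Fin N, 3 * δ := Finset.sum_le_sum fun i _ => by
          split_ifs with hi
          · exact hbulk i hi.1 hi.2
          · rw [abs_zero]; positivity
      _ = 3 * δ * N := by
          rw [Finset.sum_const, Finset.card_univ, Fintype.card_fin, nsmul_eq_mul]; ring
  have hsum2 : |∑ i : Fin N, if L' ≤ i.val ∧ i.val + L' < N then 0 else row i - CT| ≤ 2 * L' * Rb := by
    refine (Finset.abs_sum_le_sum_abs _ _).trans ?_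
    calc (∑ i : Fin N, |if L' ≤ i.val ∧ i.val + L' < N then 0 else row i - CT|)
        ≤ ∑ i : Fin N, if L' ≤ i.val ∧ i.val + L' < N then 0 else Rb :=
          Finset.sum_le_sum fun i _ => by
            split_ifs with hi
            · rw [abs_zero]
            · exact hbdry i
      _ ≤ 2 * L' * Rb := sum_ite_not_bulk_const_le N L' hRb0
  -- the boundary is `o(N)`: `2L'·Rb = L'λM + 3L'MN/λ + 2L'|C_T| ≤ A + δN ≤ 2δN`
  have h3 : 3 * L' * M * N / lam' ≤ δ * N := by
    rw [div_le_iff₀ hlam']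
    have h : 3 * L' * M ≤ δ * lam' := by
      rw [hlam'def, mul_add, mul_div_cancel₀ _ hδ0.ne']
      linarith
    nlinarith [hNr.le]
  have h4 : A ≤ δ * N := by
    have h := (Nat.ceil_le).1 hN₄
    rwa [div_le_iff₀' hδ0] at h
  have h5 : 2 * L' * Rb = (L' : ℝ) * lam' * M + 3 * L' * M * N / lam' + 2 * L' * |CT| := by
    rw [hRb]
    field_simp
  rw [e2]
  calc |(∑ i : Fin N, if L' ≤ i.val ∧ i.val + L' < N then row i - CT else 0) +
        ∑ i : Fin N, if L' ≤ i.val ∧ i.val + L' < N then 0 else row i - CT|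
      ≤ 3 * δ * N + 2 * L' * Rb := (abs_add_le _ _).trans (add_le_add hsum1 hsum2)
    _ ≤ 3 * δ * N + δ * N + δ * N := by rw [h5]; linarith
    _ < ε * N := by rw [hδ]; nlinarith

/-- **Registered reduction stub `stub_fixedTimeMatchingOfUniformLeaves` — the residual of S3 from the
two ANCHOR-UNIFORM dynamical leaves.** For `P = pinnedChain ω₂ lam β γ` (all `> 0`), `T > 0`, any state
`μT` and dynamics `D` with absolutely convergent summed current correlations:
(B') ANCHOR-UNIFORM PER-OFFSET FIXED-TIME MATCHING — for every offset `x`, `t > 0` and `ε > 0` there are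
`L`, `N₀` with `|⟨j_i(0) j_{i+x}(t)⟩_{N,T} - ∫ j_0 · (j_x ∘ φ_t) dμT| ≤ ε` for all `N ≥ N₀` and all anchors
`i` with `L ≤ i`, `i + L < N` (two-dynamics coupling on bulk windows + convergence of the bulk window
laws of `gibbsMeasure N T` to the regular DLR state; the anchor-uniform form of the sibling leaf
`stub_fixedTimeOffsetMatching`), and
(C') ANCHOR-UNIFORM CORRELATION TAILS AT FIXED TIME — for every `t > 0`, `ε > 0` there are `R`, `N₀` with
`Σ_{|k-i|>R} |⟨j_i(0) j_k(t)⟩_{N,T}| ≤ ε` for all `N ≥ N₀` and all anchors `i` with `R ≤ i`, `i + R < N`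
(light cone of the open chain at fixed time; the anchor-uniform, pointwise-in-`t` form of the sibling
leaf `stub_anchoredCorrelationTails`),
imply the FIXED-TIME bond-averaged matching `c_N(t)/N → C_T(t)` for every `t > 0` — the hypothesis of
`stub_fixedFrequencyMatchingOfFixedTime` (part 2) in its everywhere form. [folklore] -/
theorem stub_fixedTimeMatchingOfUniformLeaves :
    ∀ ω₂ lam β γ : ℝ, 0 < ω₂ → 0 < lam → 0 < β → 0 < γ → ∀ T : ℝ, 0 < T →
     ∀ (μT : MeasureTheory.Measure Literature.MathematicalPhysics.KineticTheory.HeatConduction.ChainConfig)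
      (D : Literature.MathematicalPhysics.KineticTheory.HeatConduction.InfiniteChainDynamics
       (Literature.MathematicalPhysics.KineticTheory.HeatConduction.pinnedChain ω₂ lam β γ)),
     (∀ t : ℝ, D.HasAbsConvergentCorrelation μT t) →
     (∀ (x : ℤ) (t : ℝ), 0 < t → ∀ ε : ℝ, 0 < ε → ∃ L N₀ : ℕ, ∀ N : ℕ, N₀ ≤ N → ∀ i k : Fin N,
      L ≤ i.val → i.val + L < N → (k.val : ℤ) = i.val + x →
      |(∫ z, (Literature.MathematicalPhysics.KineticTheory.HeatConduction.pinnedChain ω₂ lam β γ).bondCurrent N i z *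
         (∫ y, (Literature.MathematicalPhysics.KineticTheory.HeatConduction.pinnedChain ω₂ lam β γ).bondCurrent N k y
          ∂((Literature.MathematicalPhysics.KineticTheory.HeatConduction.pinnedChain
           ω₂ lam β γ).transitionKernel N T T t.toNNReal z))
         ∂((Literature.MathematicalPhysics.KineticTheory.HeatConduction.pinnedChain ω₂ lam β γ).gibbsMeasure N T)) -
        ∫ σ, (Literature.MathematicalPhysics.KineticTheory.HeatConduction.pinnedChain ω₂ lam β γ).bondCurrentZ σ 0 *
         (Literature.MathematicalPhysics.KineticTheory.HeatConduction.pinnedChain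
          ω₂ lam β γ).bondCurrentZ (D.flow t σ) x ∂μT| ≤ ε) →
     (∀ t : ℝ, 0 < t → ∀ ε : ℝ, 0 < ε → ∃ R N₀ : ℕ, ∀ N : ℕ, N₀ ≤ N → ∀ i : Fin N,
      R ≤ i.val → i.val + R < N →
      (∑ k : Fin N, if i.val ≤ k.val + R ∧ k.val ≤ i.val + R then (0 : ℝ) else
       |∫ z, (Literature.MathematicalPhysics.KineticTheory.HeatConduction.pinnedChain ω₂ lam β γ).bondCurrent N i z *
         (∫ y, (Literature.MathematicalPhysics.KineticTheory.HeatConduction.pinnedChain ω₂ lam β γ).bondCurrent N k y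
          ∂((Literature.MathematicalPhysics.KineticTheory.HeatConduction.pinnedChain
           ω₂ lam β γ).transitionKernel N T T t.toNNReal z))
        ∂((Literature.MathematicalPhysics.KineticTheory.HeatConduction.pinnedChain ω₂ lam β γ).gibbsMeasure N T)|)
       ≤ ε) →
     ∀ t : ℝ, 0 < t →
      Filter.Tendsto (fun N : ℕ =>
       (∫ z, (∑ i : Fin N, (Literature.MathematicalPhysics.KineticTheory.HeatConduction.pinnedChain
           ω₂ lam β γ).bondCurrent N i z) *
         (∫ y, (∑ i : Fin N, (Literature.MathematicalPhysics.KineticTheory.HeatConduction.pinnedChain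
           ω₂ lam β γ).bondCurrent N i y)
          ∂((Literature.MathematicalPhysics.KineticTheory.HeatConduction.pinnedChain
           ω₂ lam β γ).transitionKernel N T T t.toNNReal z))
         ∂((Literature.MathematicalPhysics.KineticTheory.HeatConduction.pinnedChain
           ω₂ lam β γ).gibbsMeasure N T)) / (N : ℝ))
       Filter.atTop (nhds (D.currentCorrelation μT t)) := by
  intro ω₂ lam β γ hω hl hβ hγ T hT μT D hAC hB hC t ht
  exact tendsto_totalCurrentAutocorr_div_of_uniformLeaves hω hl hβ hγ hT (hAC t)
    (fun x ε hε => hB x t ht ε hε) (hC t ht)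


/-- **S3 from the two anchor-uniform dynamical leaves.** The hypotheses of the registered stub S3
`stub_fixedFrequencyMatching` (for `P = pinnedChain ω₂ lam β γ`, all `> 0`, `T > 0` with DLR uniqueness in
the regular class, a regular witness `(μT, D)`), plus (B') anchor-uniform per-offset fixed-time matching
and (C') anchor-uniform correlation tails at fixed time, imply S3's conclusion
`F_N(ν)/N → ∫₀^∞ e^{-νt} C_T(t) dt` at every `ν > 0`: the fixed-time bond-averaged matching holds at every
`t > 0` (`stub_fixedTimeMatchingOfUniformLeaves`), hence a.e. on `(0,∞)`, and part 2
(`stub_fixedFrequencyMatchingOfFixedTime`) concludes. So S3 follows BY NAME from (B') and (C').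
[folklore] -/
theorem fixedFrequencyMatching_of_uniformLeaves :
        ∀ ω₂ lam β γ : ℝ, 0 < ω₂ → 0 < lam → 0 < β → 0 < γ → ∀ T : ℝ, 0 < T →
      (∀ μ₁ μ₂ : MeasureTheory.Measure
            Literature.MathematicalPhysics.KineticTheory.HeatConduction.ChainConfig,
          (Literature.MathematicalPhysics.KineticTheory.HeatConduction.pinnedChain
                ω₂ lam β γ).IsChainGibbsMeasure T μ₁ →
          Literature.MathematicalPhysics.KineticTheory.HeatConduction.IsShiftInvariant μ₁ →
          (Literature.MathematicalPhysics.KineticTheory.HeatConduction.pinnedChain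
                ω₂ lam β γ).HasSuperstabilityEstimate μ₁ →
          (Literature.MathematicalPhysics.KineticTheory.HeatConduction.pinnedChain
                ω₂ lam β γ).IsChainGibbsMeasure T μ₂ →
          Literature.MathematicalPhysics.KineticTheory.HeatConduction.IsShiftInvariant μ₂ →
          (Literature.MathematicalPhysics.KineticTheory.HeatConduction.pinnedChain
                ω₂ lam β γ).HasSuperstabilityEstimate μ₂ → μ₁ = μ₂) →
      ∀ (μT : MeasureTheory.Measure
            Literature.MathematicalPhysics.KineticTheory.HeatConduction.ChainConfig)
        (D : Literature.MathematicalPhysics.KineticTheory.HeatConduction.InfiniteChainDynamics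
          (Literature.MathematicalPhysics.KineticTheory.HeatConduction.pinnedChain ω₂ lam β γ)),
        (Literature.MathematicalPhysics.KineticTheory.HeatConduction.pinnedChain
            ω₂ lam β γ).IsChainGibbsMeasure T μT →
        Literature.MathematicalPhysics.KineticTheory.HeatConduction.IsShiftInvariant μT →
        (Literature.MathematicalPhysics.KineticTheory.HeatConduction.pinnedChain
            ω₂ lam β γ).HasSuperstabilityEstimate μT →
        D.carrier ⊆ (Literature.MathematicalPhysics.KineticTheory.HeatConduction.pinnedChain
            ω₂ lam β γ).bmGood →
        D.PreservesMeasure μT →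
        (∀ t : ℝ, D.HasAbsConvergentCorrelation μT t) →
        (∀ (x : ℤ) (t : ℝ), 0 < t → ∀ ε : ℝ, 0 < ε → ∃ L N₀ : ℕ, ∀ N : ℕ, N₀ ≤ N → ∀ i k : Fin N,
          L ≤ i.val → i.val + L < N → (k.val : ℤ) = i.val + x →
          |(∫ z, (Literature.MathematicalPhysics.KineticTheory.HeatConduction.pinnedChain ω₂ lam β γ).bondCurrent N i z *
              (∫ y, (Literature.MathematicalPhysics.KineticTheory.HeatConduction.pinnedChain ω₂ lam β γ).bondCurrent N k y
                ∂((Literature.MathematicalPhysics.KineticTheory.HeatConduction.pinnedChain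
                  ω₂ lam β γ).transitionKernel N T T t.toNNReal z))
              ∂((Literature.MathematicalPhysics.KineticTheory.HeatConduction.pinnedChain ω₂ lam β γ).gibbsMeasure N T)) -
            ∫ σ, (Literature.MathematicalPhysics.KineticTheory.HeatConduction.pinnedChain ω₂ lam β γ).bondCurrentZ σ 0 *
              (Literature.MathematicalPhysics.KineticTheory.HeatConduction.pinnedChain
                ω₂ lam β γ).bondCurrentZ (D.flow t σ) x ∂μT| ≤ ε) →
        (∀ t : ℝ, 0 < t → ∀ ε : ℝ, 0 < ε → ∃ R N₀ : ℕ, ∀ N : ℕ, N₀ ≤ N → ∀ i : Fin N,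
          R ≤ i.val → i.val + R < N →
          (∑ k : Fin N, if i.val ≤ k.val + R ∧ k.val ≤ i.val + R then (0 : ℝ) else
            |∫ z, (Literature.MathematicalPhysics.KineticTheory.HeatConduction.pinnedChain ω₂ lam β γ).bondCurrent N i z *
                (∫ y, (Literature.MathematicalPhysics.KineticTheory.HeatConduction.pinnedChain ω₂ lam β γ).bondCurrent N k y
                  ∂((Literature.MathematicalPhysics.KineticTheory.HeatConduction.pinnedChain
                    ω₂ lam β γ).transitionKernel N T T t.toNNReal z))
              ∂((Literature.MathematicalPhysics.KineticTheory.HeatConduction.pinnedChain ω₂ lam β γ).gibbsMeasure N T)|)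
            ≤ ε) →
        ∀ ν : ℝ, 0 < ν →
          Filter.Tendsto (fun N : ℕ =>
              MeasureTheory.integral (MeasureTheory.volume.restrict (Set.Ioi (0:ℝ))) (fun t : ℝ =>
                Real.exp (-(ν * t)) *
                  ∫ z, (∑ i : Fin N, (Literature.MathematicalPhysics.KineticTheory.HeatConduction.pinnedChain
                          ω₂ lam β γ).bondCurrent N i z) *
                    (∫ y, (∑ i : Fin N, (Literature.MathematicalPhysics.KineticTheory.HeatConduction.pinnedChain
                          ω₂ lam β γ).bondCurrent N i y)
                      ∂((Literature.MathematicalPhysics.KineticTheory.HeatConduction.pinnedChain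
                          ω₂ lam β γ).transitionKernel N T T t.toNNReal z))
                    ∂((Literature.MathematicalPhysics.KineticTheory.HeatConduction.pinnedChain
                          ω₂ lam β γ).gibbsMeasure N T)) / (N : ℝ))
            Filter.atTop
            (nhds (MeasureTheory.integral (MeasureTheory.volume.restrict (Set.Ioi (0:ℝ)))
              (fun t : ℝ => Real.exp (-(ν * t)) * D.currentCorrelation μT t))) := by
  intro ω₂ lam β γ hω hl hβ hγ T hT hU μT D hG hS hss hcar hPres hAC hB hC ν hν
  exact stub_fixedFrequencyMatchingOfFixedTime ω₂ lam β γ hω hl hβ hγ T hT hU μT D hG hS hss hcar hPres hAC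
    ((ae_restrict_iff' measurableSet_Ioi).2 (ae_of_all _ fun t (ht : t ∈ Set.Ioi (0 : ℝ)) =>
      stub_fixedTimeMatchingOfUniformLeaves ω₂ lam β γ hω hl hβ hγ T hT μT D hAC hB hC t ht)) ν hν

end Summit.AtomisticToContinuum.FouriersLaw.Theorems.AbelThermodynamicLimit.SeriesLawAtEveryLaplaceFrequency

end
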